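import Literature.MathematicalPhysics.QuantumFieldTheory.Balaban1983to89.B13Term214

/-!
# T⁴ programme, spine estimate NE1′ (node O3b/H2) — SUPPLIER BRICK for OPEN OFFER O-owner-g43-1 «(B1b-dict)», step (ii) of the owner's plan:
# THE TWO NESTED GAUSSIAN MEANS OF (2.14) MERGE INTO ONE INTEGRAL — `core214 A Γ F σ τ = N(σ)·∫ e^{−q_σ(X,B)}·F(τ,B) d(X,B)` over the
# product of the two real field spaces, with the EXPLICIT complex exponent `q_σ(X,B) = ½⟨X,X⟩ + ½⟨ΓX, A⁻¹ΓX⟩ + ½⟨B, AB⟩ + ⟨B, ΓX⟩` and the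
# normaliser `N(σ) = (∫e^{−½⟨X,X⟩})⁻¹·(∫e^{−½⟨B,A(σ)B⟩})⁻¹` — pure FUBINI (one integrability hypothesis), no holomorphy, no estimate

Cell `pub-balaban`, sub-cell `t4`, BINDER-OWNERS row NE1′; NE1′ formalisation crew, unit `b2b-balaban-t4-ne1p-formalise-leaf-08` (LEAF PROVER
08, gen 14); crew row S72 ∕ DAG N29zzzzzzl of `t4/formal/NE1p/LEAVES.md` (BOOKED typer R-T159, journal l.26295; cap 150; X-read X269).  A SUPPLIER BRICK, usable BY NAME by whichever lineage takes O-owner-g43-1 (owner t4-ne1p-p1 g43, `HOME/CLAIMS.log` l.25745∕l.25756,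
memo `HOME/b2b-balaban-t4-ne1p-p1/g43/E-ne1pp1-g43-1.md` §2: «(ii) the two nested Gaussian means ↦ `N·∫_V … dvol` (Fubini on (X,B); …)» — the
sibling of leaf-10-g14's step-(i) brick `Support/B13Term214TopCIntegral`); it is NOT a claim on the offer (no `BiCore.ofBlock`, no `TopC`
step (i), no `F214`∕`readOut` step (iii), no transport to the `WithLp 2` fluctuation space).  ADDITIVE — imports the Literature module L9
`Literature/…/Balaban1983to89/B13Term214` (p243751) ONLY (`cquad`, `cgaussWeight`, `cgaussInt`, `cgaussNorm`, `cgaussMean`, `integrand214`,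
`core214` BY NAME) + Mathlib (`MeasureTheory.integral_prod`, `MeasureTheory.integral_const_mul`, `MeasureTheory.Measure.volume_eq_prod`,
`Complex.exp_add`).  THEOREMS ONLY; 0 `def`, 0 `instance`, 0 `def … : Prop`, 0 cite, 0 sorry, 0 `attribute`; nothing of L9 restated.

WHY THIS FILE.  [Balaban1988RGII] p. 15 (2.14) displays the `X`-integral `∫dμ₀(X)|_Z exp(−½⟨Γ_k X, C^{(k)}Γ_k X⟩) · ∫dμ_{C^{(k)}}(B) exp(−⟨B, Γ_k X⟩)
· (−1)^{|P|}χ χᶜ exp[Σ τ(Y)V_k(Y,B)]` as TWO nested normalised Gaussian means (LOCUS of the audited manuscript, TYPE∕CONTEXT only — L9 types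
it as the object `core214 A Γ F σ τ = cgaussMean 1 (X ↦ integrand214 (A σ) (Γ σ) (F τ) X)`, nothing asserted); the cell's term format
(NE5 `BiCore.termAt`) carries ONE integral `∫ v, chi v·e^{readOut p v h}·e^{−q o p v} ∂vol` over ONE flat fluctuation space with ONE quadratic-
plus-linear complex exponent.  The dictionary between the two needs, at this spot, exactly Fubini:
* §1 [folklore] **`gaussWeights_mul_eq_cexp_neg_merged`**: the pointwise identity
  `e^{−½⟨X,X⟩}·(e^{−½⟨ΓX,A⁻¹ΓX⟩}·(e^{−½⟨B,AB⟩}·(e^{−⟨B,ΓX⟩}·F(B)))) = e^{−q(X,B)}·F(B)` with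
  `q(X,B) = ½·cquad 1 X + ½·(ΓX ⬝ A⁻¹ΓX) + ½·cquad A B + (B ⬝ ΓX)` (`Complex.exp_add`);
* §2 [folklore] **`integrand214_mul_weight_eq_integral`**: for each `X`, `e^{−½⟨X,X⟩}·integrand214 A Γ F X = (cgaussNorm A)⁻¹ · ∫_B e^{−q(X,B)}·F(B)`
  (`integral_const_mul`, §1 under the `B`-integral);
* §3 **`core214_eq_integral_prod`** (kernel): under ONE hypothesis — `(X,B) ↦ e^{−q_σ(X,B)}·F(τ,B)` integrable for the product Lebesgue measure —
  `core214 A Γ F σ τ = (cgaussNorm 1)⁻¹ · ((cgaussNorm (A σ))⁻¹ · ∫_{(X,B)} e^{−q_σ(X,B)}·F(τ,B))` (`integral_prod` + `Measure.volume_eq_prod` + §2) —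
  (2.14)'s lines 2–4 as ONE integral against ONE density, the shape of `BiCore.termAt`'s inner integral (`chi·e^{readOut}` ↔ `F`, `e^{−q}` ↔
  `e^{−q_σ}`, `N` ↔ the two inverse normalisers), ready for the taker's transport to the cell's `WithLp 2` fluctuation space and `readOut` step.

HONEST FRAMING.  [folklore] Fubini and the functional equation of `exp` on L9's OBJECTS (definitions of the audited manuscript's (2.14) over
r10's finite-dimensional block model) BY NAME; an IDENTITY OF DEFINITIONS under an integrability hypothesis — NO estimate of [Balaban1988RGII],
no holomorphy (`SepHolOn` not used), no statement about Bałaban's densities beyond the block model's letters; the identification «block model ↔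
Bałaban's densities» stays the READING (B1b-dens) of the owner's split (E-ne1pp1-g43-1 §1(b)); (B1b) stays READING until the offer's dictionary
module lands; (w1) ∕ (I4′) ∕ (B3) ∕ (B5) ∕ the met half NOT touched; 0 binders instantiated on Bałaban's densities; discharges no wall item; wall v1.8
(T4-DAG v48–v57) — words AND kind — does NOT move; R-t4r2-Q2 NOT met thereby; NE1′ ⇐ the named binders — NOT proved, NOT printed; spine PROVED 0∕9;
count 9 unchanged.  Rung (B)+1 on ONE finite four-torus — NOT infinite volume, NOT a mass gap, NOT OS on ℝ⁴, NOT Clay.  ABSOLUTE RULE honoured: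
(2.14) p. 15 is a LOCUS, TYPE∕CONTEXT only; L9 is a cite-tagged Literature module used BY NAME; the owner's memo is a CELL record quoted as such;
nothing internally minted is cited as a fact; [folklore] tags on kernel lemmas only.  HONEST DEPENDENCY: continuum YM on T⁴ ⇐ BetaPertH ∧ nine
spine estimates (0/9 proved); BetaPertH ⇐ (D1) ∧ (D4) ∧ CAP+tail; G-an2-4 gates asym, D1 and NE2/3/4.
-/

noncomputable section

namespace Summit.QuantumFields.BalabanUV.T4Continuum.B13Term214GaussMerge

open Complex MeasureTheory Matrix
open Literature.MathematicalPhysics.QuantumFieldTheory.Balaban1983to89.B13Term214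

variable {Λ C : Type} [Fintype Λ] [DecidableEq Λ] [Fintype C] [DecidableEq C]

/-! ## §1 [folklore] The four exponentials of (2.14)'s lines 2–4 are one exponential -/

/-- **THE MERGED EXPONENT** [folklore] (`Complex.exp_add`): for every white noise `X`, interior field `B`, precision `A`, coupling `Γ` and last-line
factor `F`, `e^{−½·cquad 1 X}·(e^{−½(ΓX ⬝ A⁻¹ΓX)}·(e^{−½·cquad A B}·(e^{−(B ⬝ ΓX)}·F B))) = e^{−(½·cquad 1 X + ½(ΓX ⬝ A⁻¹ΓX) + ½·cquad A B + B ⬝ ΓX)}·F B` —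
the weights `cgaussWeight 1 X`, `cgaussWeight A B` of L9 unfolded (TYPE: [Balaban1988RGII] (2.14) p. 15, lines 2–4). -/
theorem gaussWeights_mul_eq_cexp_neg_merged (A : Matrix Λ Λ ℂ) (Γ : (Λ ⊕ C → ℝ) → (Λ → ℂ)) (F : (Λ → ℝ) → ℂ)
    (X : Λ ⊕ C → ℝ) (B : Λ → ℝ) :
    cgaussWeight (1 : Matrix (Λ ⊕ C) (Λ ⊕ C) ℂ) X * (cexp (-(1 / 2 : ℂ) * (Γ X ⬝ᵥ (A⁻¹ *ᵥ Γ X))) *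
      (cgaussWeight A B * (cexp (-((fun i => (B i : ℂ)) ⬝ᵥ Γ X)) * F B))) =
      cexp (-((1 / 2 : ℂ) * cquad (1 : Matrix (Λ ⊕ C) (Λ ⊕ C) ℂ) X + (1 / 2 : ℂ) * (Γ X ⬝ᵥ (A⁻¹ *ᵥ Γ X)) +
        (1 / 2 : ℂ) * cquad A B + ((fun i => (B i : ℂ)) ⬝ᵥ Γ X))) * F B := by
  unfold cgaussWeight
  rw [show -((1 / 2 : ℂ) * cquad (1 : Matrix (Λ ⊕ C) (Λ ⊕ C) ℂ) X + (1 / 2 : ℂ) * (Γ X ⬝ᵥ (A⁻¹ *ᵥ Γ X)) +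
      (1 / 2 : ℂ) * cquad A B + ((fun i => (B i : ℂ)) ⬝ᵥ Γ X)) =
      (-(1 / 2 : ℂ) * cquad (1 : Matrix (Λ ⊕ C) (Λ ⊕ C) ℂ) X) + (-(1 / 2 : ℂ) * (Γ X ⬝ᵥ (A⁻¹ *ᵥ Γ X))) +
        ((-(1 / 2 : ℂ) * cquad A B) + (-((fun i => (B i : ℂ)) ⬝ᵥ Γ X))) by ring,
    Complex.exp_add, Complex.exp_add, Complex.exp_add]
  ring

/-! ## §2 [folklore] One white noise at a time: the inner mean times the outer weight is one `B`-integral -/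

/-- **`e^{−½⟨X,X⟩}·(2.14)'s lines 2–3 at `X` = (∫e^{−½⟨B,AB⟩})⁻¹ · ∫_B e^{−q(X,B)}·F(B)`** [folklore] (L9 `integrand214`, `cgaussMean`, `cgaussInt`
unfolded; the `X`-dependent constants pushed under the `B`-integral by `integral_const_mul`; §1 pointwise). -/
theorem weight_mul_integrand214_eq_integral (A : Matrix Λ Λ ℂ) (Γ : (Λ ⊕ C → ℝ) → (Λ → ℂ)) (F : (Λ → ℝ) → ℂ) (X : Λ ⊕ C → ℝ) :
    cgaussWeight (1 : Matrix (Λ ⊕ C) (Λ ⊕ C) ℂ) X * integrand214 A Γ F X =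
      (cgaussNorm A)⁻¹ * ∫ B : Λ → ℝ, cexp (-((1 / 2 : ℂ) * cquad (1 : Matrix (Λ ⊕ C) (Λ ⊕ C) ℂ) X +
        (1 / 2 : ℂ) * (Γ X ⬝ᵥ (A⁻¹ *ᵥ Γ X)) + (1 / 2 : ℂ) * cquad A B + ((fun i => (B i : ℂ)) ⬝ᵥ Γ X))) * F B := by
  unfold integrand214 cgaussMean cgaussInt
  rw [show cgaussWeight (1 : Matrix (Λ ⊕ C) (Λ ⊕ C) ℂ) X * (cexp (-(1 / 2 : ℂ) * (Γ X ⬝ᵥ (A⁻¹ *ᵥ Γ X))) *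
      ((cgaussNorm A)⁻¹ * ∫ B : Λ → ℝ, cgaussWeight A B * (cexp (-((fun i => (B i : ℂ)) ⬝ᵥ Γ X)) * F B))) =
      (cgaussNorm A)⁻¹ * ((cgaussWeight (1 : Matrix (Λ ⊕ C) (Λ ⊕ C) ℂ) X * cexp (-(1 / 2 : ℂ) * (Γ X ⬝ᵥ (A⁻¹ *ᵥ Γ X)))) *
        ∫ B : Λ → ℝ, cgaussWeight A B * (cexp (-((fun i => (B i : ℂ)) ⬝ᵥ Γ X)) * F B)) by ring,
    ← integral_const_mul]
  congr 1
  refine integral_congr_ae (Filter.Eventually.of_forall fun B => ?_)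
  beta_reduce
  rw [mul_assoc, gaussWeights_mul_eq_cexp_neg_merged]

/-! ## §3 THE TWO GAUSSIAN MEANS MERGE: (2.14)'s lines 2–4 as ONE integral against ONE density -/

/-- **`core214 A Γ F σ τ = (cgaussNorm 1)⁻¹ · (cgaussNorm (A σ))⁻¹ · ∫_{(X,B)} e^{−q_σ(X,B)}·F(τ, B) d(X,B)`** (kernel; L9 `core214` = the outer mean
`cgaussMean 1` of `integrand214`, unfolded; §2 under the `X`-integral; `integral_const_mul`; Mathlib `integral_prod` on the product Lebesgue
measure `volume = volume.prod volume` of `(Λ ⊕ C → ℝ) × (Λ → ℝ)`): under the ONE hypothesis that the merged integrand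
`(X,B) ↦ e^{−q_σ(X,B)}·F(τ,B)`, `q_σ(X,B) = ½·cquad 1 X + ½(Γ_σX ⬝ A_σ⁻¹Γ_σX) + ½·cquad A_σ B + B ⬝ Γ_σX`, is integrable, the `X`-integral of
[Balaban1988RGII] (2.14) (lines 2–4, TWO nested normalised Gaussian means — TYPE) is ONE integral of ONE exponential-times-`F` density with the two
inverse normalisers in front — the shape of the cell's `BiCore.termAt` inner integral `N·∫ chi·e^{readOut}·e^{−q} ∂vol` (the taker of
O-owner-g43-1 supplies the transport to `WithLp 2` and the `readOut`∕`chi` identification; nothing of that here).  Pure Fubini; `SepHolOn` and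
every estimate of print untouched. [folklore] -/
theorem core214_eq_integral_prod {ι D : Type*} (A : (ι → ℂ) → Matrix Λ Λ ℂ) (Γ : (ι → ℂ) → (Λ ⊕ C → ℝ) → (Λ → ℂ))
    (F : (D → ℂ) → (Λ → ℝ) → ℂ) (σ : ι → ℂ) (τ : D → ℂ)
    (hint : Integrable (fun XB : (Λ ⊕ C → ℝ) × (Λ → ℝ) =>
      cexp (-((1 / 2 : ℂ) * cquad (1 : Matrix (Λ ⊕ C) (Λ ⊕ C) ℂ) XB.1 + (1 / 2 : ℂ) * (Γ σ XB.1 ⬝ᵥ ((A σ)⁻¹ *ᵥ Γ σ XB.1)) +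
        (1 / 2 : ℂ) * cquad (A σ) XB.2 + ((fun i => (XB.2 i : ℂ)) ⬝ᵥ Γ σ XB.1))) * F τ XB.2)) :
    core214 A Γ F σ τ =
      (cgaussNorm (1 : Matrix (Λ ⊕ C) (Λ ⊕ C) ℂ))⁻¹ * ((cgaussNorm (A σ))⁻¹ *
        ∫ XB : (Λ ⊕ C → ℝ) × (Λ → ℝ), cexp (-((1 / 2 : ℂ) * cquad (1 : Matrix (Λ ⊕ C) (Λ ⊕ C) ℂ) XB.1 +
          (1 / 2 : ℂ) * (Γ σ XB.1 ⬝ᵥ ((A σ)⁻¹ *ᵥ Γ σ XB.1)) + (1 / 2 : ℂ) * cquad (A σ) XB.2 + ((fun i => (XB.2 i : ℂ)) ⬝ᵥ Γ σ XB.1))) *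
            F τ XB.2) := by
  unfold core214
  -- the outer mean, unfolded once: `cgaussMean 1 Ψ = (cgaussNorm 1)⁻¹ * ∫ X, cgaussWeight 1 X * Ψ X`
  show (cgaussNorm (1 : Matrix (Λ ⊕ C) (Λ ⊕ C) ℂ))⁻¹ *
      (∫ X : Λ ⊕ C → ℝ, cgaussWeight (1 : Matrix (Λ ⊕ C) (Λ ⊕ C) ℂ) X * integrand214 (A σ) (Γ σ) (F τ) X) = _
  congr 1
  simp_rw [weight_mul_integrand214_eq_integral]
  rw [integral_const_mul, MeasureTheory.Measure.volume_eq_prod, integral_prod _ hint]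

end Summit.QuantumFields.BalabanUV.T4Continuum.B13Term214GaussMerge

end
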